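/-
Copyright (c) 2026. All rights reserved.
Released under Apache 2.0 license as described in the file LICENSE.
-/
import Literature.Geometry.Riemannian.CurvatureAsDivergence
import Literature.Geometry.Lorentzian.GradientSection
import Literature.Geometry.Lorentzian.ExtensionProofs
import Literature.Topology.FourManifolds.FlowFibreMorseAlgebra
import Literature.Topology.FourManifolds.MorseTurnAbout

/-!
# Gauss–Bonnet, Morse-theoretic step: the gradient field of a Morse function

[scope: pseudo-Riemannian/manifold]

For the Poincaré–Hopf proof of the Gauss–Bonnet theorem
(`Literature/Geometry/Riemannian/GaussBonnet.lean`) we need a smooth vector field on a closed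
surface with finitely many nondegenerate zeros whose indices add up to the Euler characteristic.
We take the gradient `grad_g f` of a Morse function `f` (these exist by `exists_isMorse_holds` and
have finitely many critical points, counted by the Euler characteristic in
`SphereMorseCount.morseCount_eq_relEuler`). This file proves:

* `grad`, `contMDiffAt_grad` — the gradient of a smooth function is a smooth vector field;
* `grad_eq_zero_iff` — its zeros are the critical points;
* `metricRep_vectorRep_grad` — in a chart, `Ĝ_e(Ŷ e, w) = D(f ∘ φ⁻¹)(e) w`;
* `metricRep_fderiv_vectorRep_grad` — at a critical point, `Ĝ_c(L v, w) = Hess f (v, w)` where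
  `L = DŶ(c)` is the linearization of the gradient in the chart;
* `det_div_abs_det_eq_neg_one_pow_sigNeg` — linear algebra on a `2`-dimensional space: for a
  positive definite `G`, an endomorphism `L` and the symmetric nondegenerate form
  `B(v, w) = G(L v, w)`, `det L ≠ 0` and `det L / |det L| = (−1)^{b⁻(B)}`;
* `exists_linearization_grad` — at a critical point `p` of a Morse function on a Riemannian
  surface, the chart linearization `L` of `grad f` is invertible and
  `det L / |det L| = (−1)^{index_p f}`.

## References

* J. Milnor, *Morse theory* (1963), §2, §6.
* J. M. Lee, *Introduction to Riemannian Manifolds* (2018), Thm. 9.7. [folklore]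
-/

open Bundle Set Function Filter Module
open Literature.Geometry.Lorentzian Literature.Geometry.Lorentzian.PseudoRiemannianMetric
open Literature.Geometry.Lorentzian.MetricCoord Literature.Topology.FourManifolds
open scoped Manifold ContDiff Topology RealInnerProductSpace

noncomputable section

namespace Literature.Geometry.Riemannian

/-! ### The gradient field of a smooth function -/

section Gradient

variable {E : Type*} [NormedAddCommGroup E] [NormedSpace ℝ E] {H : Type*} [TopologicalSpace H]
  {I : ModelWithCorners ℝ E H} {M : Type*} [TopologicalSpace M] [ChartedSpace H M]
  [IsManifold I ∞ M] [FiniteDimensional ℝ E] [I.Boundaryless]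
  (g : PseudoRiemannianMetric I ∞ E (TangentSpace I : M → Type _))

/-- **The gradient field** `grad_g f = ♯(df)` of a function `f : M → ℝ`. O'Neill 1983, Ch. 3,
Def. 3.9 ff. [cite: ONeill1983, Ch. 3, Def. 3.9] -/
def grad (f : M → ℝ) (x : M) : TangentSpace I x :=
  g.sharp x (mvfderiv I f x).toLinearMap

omit [I.Boundaryless] in
/-- Unfolding lemma for `grad`. [folklore] -/
theorem grad_apply (f : M → ℝ) (x : M) :
    grad g f x = g.sharp x (mvfderiv I f x).toLinearMap := rfl

omit [I.Boundaryless] in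
/-- Defining property of the gradient: `g(grad f, w) = df(w)`. [cite: ONeill1983, Ch. 3, Def. 3.9] -/
theorem val_grad (f : M → ℝ) (x : M) (w : TangentSpace I x) :
    g.val x (grad g f x) w = mvfderiv I f x w := by
  rw [grad_apply, val_sharp_apply]
  rfl

omit [IsManifold I ∞ M] [I.Boundaryless] [FiniteDimensional ℝ E] in
/-- `mvfderiv` of a real function is `mfderiv` (abuse of the defeq `T_t ℝ = ℝ`). [folklore] -/
theorem mvfderiv_real_apply (f : M → ℝ) (x : M) (v : TangentSpace I x) :
    mvfderiv I f x v = mfderiv I 𝓘(ℝ, ℝ) f x v := rfl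

omit [I.Boundaryless] in
/-- **The zeros of the gradient are the critical points.** [cite: Milnor1963, §2] -/
theorem grad_eq_zero_iff (f : M → ℝ) (x : M) :
    grad g f x = 0 ↔ mfderiv I 𝓘(ℝ, ℝ) f x = 0 := by
  rw [grad_apply, LinearEquiv.map_eq_zero_iff]
  constructor
  · intro h
    ext v
    have := LinearMap.congr_fun h v
    exact this
  · intro h
    ext v
    show mvfderiv I f x v = 0
    rw [mvfderiv_real_apply, h]
    rfl

omit [FiniteDimensional ℝ E] in
/-- **Partial derivatives of a smooth function are smooth**: for `F : M → ℝ` smooth, `y ↦ dF_y(∂ᵢ|_y)`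
is smooth at every point `p` of the chart domain of `x₀`. [folklore] -/
theorem contMDiffAt_mvfderiv_localFrame_top {ι : Type*} [Fintype ι] (b : Module.Basis ι ℝ E)
    {x₀ p : M} {F : M → ℝ} (hp : p ∈ (chartAt H x₀).source) (hF : CMDiff ∞ F) (i : ι) :
    ContMDiffAt I 𝓘(ℝ, ℝ) ∞
      (fun y ↦ mvfderiv I F y ((trivializationAt E (TangentSpace I) x₀).localFrame b i y)) p := by
  have hz : extChartAt I x₀ p ∈ (extChartAt I x₀).target :=
    (extChartAt I x₀).map_source (by rwa [extChartAt_source])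
  have hsymm : ContMDiffAt 𝓘(ℝ, E) I ∞ (extChartAt I x₀).symm (extChartAt I x₀ p) :=
    (contMDiffOn_extChartAt_symm (n := ∞) x₀).contMDiffAt
      ((isOpen_extChartAt_target x₀).mem_nhds hz)
  have hcomp : ContMDiffAt 𝓘(ℝ, E) 𝓘(ℝ, ℝ) ∞ (F ∘ (extChartAt I x₀).symm) (extChartAt I x₀ p) :=
    (hF _).comp _ hsymm
  have hcd : ContDiffAt ℝ ∞ (F ∘ (extChartAt I x₀).symm) (extChartAt I x₀ p) :=
    contMDiffAt_iff_contDiffAt.1 hcomp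
  have hfd : ContDiffAt ℝ ∞ (fun z ↦ fderiv ℝ (F ∘ (extChartAt I x₀).symm) z (b i))
      (extChartAt I x₀ p) :=
    (hcd.fderiv_right (m := ∞) (by simp)).clm_apply contDiffAt_const
  have h1 : ContMDiffAt I 𝓘(ℝ, ℝ) ∞
      (fun y ↦ fderiv ℝ (F ∘ (extChartAt I x₀).symm) (extChartAt I x₀ y) (b i)) p :=
    hfd.contMDiffAt.comp p (contMDiffAt_extChartAt' hp)
  refine h1.congr_of_eventuallyEq ?_
  filter_upwards [(chartAt H x₀).open_source.mem_nhds hp] with y hy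
  exact mvfderiv_apply_localFrame b hy ((hF y).mdifferentiableAt (by simp)) i

/-- **The gradient of a smooth function is a smooth vector field.** On the chart domain of `p`,
`grad F = ∑ₗ (∑ₖ dF(∂ₖ) 𝒢^{kl}) ∂ₗ` with smooth coefficients. O'Neill 1983, Ch. 3, Def. 3.9 ff.
[cite: ONeill1983, Ch. 3, Def. 3.9] -/
theorem contMDiffAt_grad [CompleteSpace E] {F : M → ℝ} (hF : CMDiff ∞ F) (p : M) :
    CMDiffAt ∞ (T% (grad g F)) p := by
  classical
  set bE := Module.finBasis ℝ E with hbE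
  have hp : p ∈ (chartAt H p).source := mem_chart_source H p
  set c : Fin (Module.finrank ℝ E) → M → ℝ := fun l y ↦
    ∑ k, mvfderiv I F y ((trivializationAt E (TangentSpace I) p).localFrame bE k y) *
      (Matrix.of fun i j ↦ g.val y ((trivializationAt E (TangentSpace I) p).localFrame bE i y)
        ((trivializationAt E (TangentSpace I) p).localFrame bE j y))⁻¹ k l with hc
  have hs : ∀ l, CMDiffAt ∞ (T% ((trivializationAt E (TangentSpace I) p).localFrame bE l)) p :=
    fun l ↦ contMDiffAt_localFrame_of_mem ∞ _ bE l (by simp)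
  have hgram : ∀ i j, ContMDiffAt I 𝓘(ℝ, ℝ) ∞ (fun y ↦ g.val y
      ((trivializationAt E (TangentSpace I) p).localFrame bE i y)
      ((trivializationAt E (TangentSpace I) p).localFrame bE j y)) p := fun i j ↦
    g.contMDiffAt_val_apply le_rfl (hs i) (hs j)
  have hdet : (Matrix.of fun i j ↦ g.val p
      ((trivializationAt E (TangentSpace I) p).localFrame bE i p)
      ((trivializationAt E (TangentSpace I) p).localFrame bE j p)).det ≠ 0 :=
    det_gram_localFrame_ne_zero _ g bE (by simp)
  have hcoef : ∀ l, ContMDiffAt I 𝓘(ℝ, ℝ) ∞ (c l) p := fun l ↦ by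
    refine ContMDiffAt.sum fun k _ ↦ ?_
    exact (contMDiffAt_mvfderiv_localFrame_top bE hp hF k).mul
      (contMDiffAt_matrix_inv hgram hdet k l)
  have hσ : ∀ l,
      CMDiffAt ∞ (T% ((c l) • ((trivializationAt E (TangentSpace I) p).localFrame bE l))) p :=
    fun l ↦ (hcoef l).smul_section (hs l)
  have hsum : CMDiffAt ∞
      (T% (fun y ↦ ∑ l, ((c l) • ((trivializationAt E (TangentSpace I) p).localFrame bE l)) y))
      p :=
    ContMDiffAt.sum_section (I := I) (V := (TangentSpace I : M → Type _))
      (s := Finset.univ) (t := fun l ↦ (c l) • ((trivializationAt E (TangentSpace I) p).localFrame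
        bE l)) (x₀ := p) (fun l _ ↦ hσ l)
  refine hsum.congr_of_eventuallyEq ?_
  filter_upwards [(chartAt H p).open_source.mem_nhds hp] with y hy
  show (TotalSpace.mk' E y (grad g F y) : TangentBundle I M) =
    TotalSpace.mk' E y (∑ l, ((c l) • ((trivializationAt E (TangentSpace I) p).localFrame bE l)) y)
  congr 1
  rw [eq_sum_gram_inv_smul_localFrame g bE hy (grad g F y)]
  simp only [hc, Pi.smul_apply', val_grad]

/-- The gradient of a smooth function is smooth. [cite: ONeill1983, Ch. 3, Def. 3.9] -/
theorem contMDiff_grad [CompleteSpace E] {F : M → ℝ} (hF : CMDiff ∞ F) :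
    CMDiff ∞ (T% (grad g F)) :=
  fun p ↦ contMDiffAt_grad g hF p

/-! ### The gradient in a chart -/

omit [FiniteDimensional ℝ E] [I.Boundaryless] in
/-- `Dφ (e.symmL y w) = w` on the chart domain. [folklore] -/
theorem mfderiv_extChartAt_symmL {x₀ y : M} (hy : y ∈ (chartAt H x₀).source) (w : E) :
    mfderiv I 𝓘(ℝ, E) (extChartAt I x₀) y
      ((trivializationAt E (TangentSpace I) x₀).symmL ℝ y w) = w := by
  rw [← TangentBundle.continuousLinearMapAt_trivializationAt hy]
  exact (trivializationAt E (TangentSpace I) x₀).continuousLinearMapAt_symmL (by simpa using hy) w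

omit [FiniteDimensional ℝ E] in
/-- The differential in the chart: `df_y(e.symmL y w) = D(f ∘ φ⁻¹)(φ y) w`. [folklore] -/
theorem mvfderiv_symmL_eq_fderiv {x₀ y : M} (hy : y ∈ (chartAt H x₀).source) {f : M → ℝ}
    (hf : MDifferentiableAt I 𝓘(ℝ, ℝ) f y) (w : E) :
    mvfderiv I f y ((trivializationAt E (TangentSpace I) x₀).symmL ℝ y w) =
      fderiv ℝ (f ∘ (extChartAt I x₀).symm) (extChartAt I x₀ y) w := by
  rw [TangentBundle.symmL_trivializationAt hy]
  exact mvfderiv_apply_mfderivWithin_symm hy hf w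

omit [I.Boundaryless] [FiniteDimensional ℝ E] in
/-- Unfolding of `metricRep` through the trivialization: `Ĝ_e(v, w) = g(e.symmL v, e.symmL w)`
at `φ⁻¹ e`. [folklore] -/
theorem metricRep_apply_eq_val_symmL (x₀ : M) (e v w : E) :
    metricRep I g x₀ e v w = g.val ((extChartAt I x₀).symm e)
      ((trivializationAt E (TangentSpace I) x₀).symmL ℝ ((extChartAt I x₀).symm e) v)
      ((trivializationAt E (TangentSpace I) x₀).symmL ℝ ((extChartAt I x₀).symm e) w) := rfl

/-- **The gradient in a chart**: for `e` in the chart target and every `w`,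
`Ĝ_e(Ŷ e, w) = D(f ∘ φ⁻¹)(e) w`, where `Ŷ = vectorRep (grad f)` and `Ĝ = metricRep`.
[cite: ONeill1983, Ch. 3, Def. 3.9] -/
theorem metricRep_vectorRep_grad (x₀ : M) {f : M → ℝ} (hf : CMDiff ∞ f) {e : E}
    (he : e ∈ (extChartAt I x₀).target) (w : E) :
    metricRep I g x₀ e (vectorRep I x₀ (grad g f) e) w =
      fderiv ℝ (f ∘ (extChartAt I x₀).symm) e w := by
  have hy : (extChartAt I x₀).symm e ∈ (chartAt H x₀).source := by
    rw [← extChartAt_source I]; exact (extChartAt I x₀).map_target he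
  rw [metricRep_apply_eq_val_symmL, vectorRep_apply, C0Extension.symmL_mfderiv_extChartAt hy, val_grad,
    mvfderiv_symmL_eq_fderiv hy ((hf _).mdifferentiableAt (by simp)), (extChartAt I x₀).right_inv he]

set_option maxSynthPendingDepth 2 in
/-- **The linearization of the gradient at a critical point**: if `df_{x₀} = 0` and
`L = DŶ(φ x₀)` (`Ŷ` the chart representative of `grad f`), then
`Ĝ_{φ x₀}(L v, w) = D²(f ∘ φ⁻¹)(φ x₀)(v, w)`. [cite: Milnor1963, §2 and §6] -/
theorem metricRep_fderiv_vectorRep_grad [CompleteSpace E] (x₀ : M) {f : M → ℝ}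
    (hf : CMDiff ∞ f) (hx₀ : mfderiv I 𝓘(ℝ, ℝ) f x₀ = 0) (v w : E) :
    metricRep I g x₀ (extChartAt I x₀ x₀)
        (fderiv ℝ (vectorRep I x₀ (grad g f)) (extChartAt I x₀ x₀) v) w =
      fderiv ℝ (fderiv ℝ (f ∘ (extChartAt I x₀).symm)) (extChartAt I x₀ x₀) v w := by
  set φ := extChartAt I x₀ with hφ
  set c := φ x₀ with hc
  set Ĝ := metricRep I g x₀ with hĜ
  set Ŷ := vectorRep I x₀ (grad g f) with hŶ
  set fh := f ∘ φ.symm with hfh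
  have hct : c ∈ φ.target := mem_extChartAt_target x₀
  have hT : φ.target ∈ 𝓝 c := (isOpen_extChartAt_target x₀).mem_nhds hct
  -- smoothness of the three players near `c`
  have hĜs : ContDiffOn ℝ ∞ Ĝ φ.target := contDiffOn_chartRep_const g x₀
  have hŶs : ContDiffOn ℝ ∞ Ŷ φ.target := contDiffOn_vectorRep x₀ (contMDiff_grad g hf).contMDiffOn
  have hfhs : ContDiffOn ℝ ∞ fh φ.target :=
    contMDiffOn_iff_contDiffOn.1 (hf.comp_contMDiffOn (contMDiffOn_extChartAt_symm x₀))
  have hĜd : HasFDerivAt Ĝ (fderiv ℝ Ĝ c) c :=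
    ((hĜs.contDiffAt hT).differentiableAt (by simp)).hasFDerivAt
  have hŶd : HasFDerivAt Ŷ (fderiv ℝ Ŷ c) c :=
    ((hŶs.contDiffAt hT).differentiableAt (by simp)).hasFDerivAt
  have hfhd : HasFDerivAt (fderiv ℝ fh) (fderiv ℝ (fderiv ℝ fh) c) c :=
    (((hfhs.contDiffAt hT).fderiv_right (m := ∞) (by simp)).differentiableAt (by simp)).hasFDerivAt
  -- `Ŷ c = 0`
  have hŶc : Ŷ c = 0 := by
    have h0 : grad g f x₀ = 0 := (grad_eq_zero_iff g f x₀).2 hx₀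
    show mfderiv I 𝓘(ℝ, E) φ (φ.symm c) (grad g f (φ.symm c)) = 0
    rw [hc, extChartAt_to_inv, h0, map_zero]
  -- the two functions `e ↦ Ĝ e (Ŷ e) w` and `e ↦ D fh e w` agree on the target
  have heq : (fun e ↦ Ĝ e (Ŷ e) w) =ᶠ[𝓝 c] fun e ↦ fderiv ℝ fh e w := by
    filter_upwards [hT] with e he
    exact metricRep_vectorRep_grad g x₀ hf he w
  -- derivative of the left side
  have h1 : HasFDerivAt (fun e ↦ Ĝ e (Ŷ e)) ((Ĝ c).comp (fderiv ℝ Ŷ c)) c := by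
    have := hĜd.clm_apply hŶd
    rwa [hŶc, map_zero, add_zero] at this
  have h1w : HasFDerivAt (fun e ↦ Ĝ e (Ŷ e) w)
      ((ContinuousLinearMap.apply ℝ ℝ w).comp ((Ĝ c).comp (fderiv ℝ Ŷ c))) c :=
    (ContinuousLinearMap.apply ℝ ℝ w).hasFDerivAt.comp c h1
  -- derivative of the right side
  have h2w : HasFDerivAt (fun e ↦ fderiv ℝ fh e w)
      ((ContinuousLinearMap.apply ℝ ℝ w).comp (fderiv ℝ (fderiv ℝ fh) c)) c :=
    (ContinuousLinearMap.apply ℝ ℝ w).hasFDerivAt.comp c hfhd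
  have huniq := (h1w.congr_of_eventuallyEq heq.symm).unique h2w
  have := DFunLike.congr_fun huniq v
  simpa only [ContinuousLinearMap.comp_apply, ContinuousLinearMap.apply_apply] using this

end Gradient

/-! ### Linear algebra in dimension two: `sign det L = (−1)^{b⁻}` -/

section LinearAlgebra

variable {E : Type*} [NormedAddCommGroup E] [NormedSpace ℝ E] [FiniteDimensional ℝ E]

/-- For a `2 × 2` situation: a basis of a `2`-dimensional space indexed by `Fin 2`, orthogonal
for a given symmetric bilinear form. [folklore] -/
theorem exists_basis_fin_two_isOrtho (h2 : finrank ℝ E = 2) {B : LinearMap.BilinForm ℝ E}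
    (hB : B.IsSymm) : ∃ b : Module.Basis (Fin 2) ℝ E, B (b 0) (b 1) = 0 ∧ B (b 1) (b 0) = 0 := by
  obtain ⟨v, hv⟩ := LinearMap.BilinForm.exists_orthogonal_basis (LinearMap.BilinForm.isSymm_iff.1 hB)
  refine ⟨v.reindex (finCongr h2), ?_, ?_⟩
  · rw [Module.Basis.reindex_apply, Module.Basis.reindex_apply]
    exact hv (by simp [finCongr, Fin.ext_iff])
  · rw [Module.Basis.reindex_apply, Module.Basis.reindex_apply]
    exact hv (by simp [finCongr, Fin.ext_iff])

omit [FiniteDimensional ℝ E] in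
/-- In a basis `(ξ, η)` of a `2`-dimensional space, the kernel of the first coordinate is the
line spanned by `η`. [folklore] -/
theorem ker_coord_zero_eq_span (b : Module.Basis (Fin 2) ℝ E) :
    LinearMap.ker (b.coord 0) = Submodule.span ℝ {b 1} := by
  ext k
  rw [LinearMap.mem_ker, Submodule.mem_span_singleton]
  constructor
  · intro hk
    refine ⟨b.coord 1 k, ?_⟩
    conv_rhs => rw [← b.sum_repr k]
    rw [Fin.sum_univ_two]
    have : b.repr k 0 = 0 := hk
    rw [this, zero_smul, zero_add]
    rfl
  · rintro ⟨t, rfl⟩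
    simp

/-- **`b⁻` of a symmetric form in an orthogonal basis of a plane**:
`b⁻(B) = [B(ξ,ξ) < 0] + [B(η,η) < 0]`. [cite: Milnor1963, §2] -/
theorem sigNeg_eq_of_basis_fin_two {B : LinearMap.BilinForm ℝ E} (hB : B.IsSymm)
    (b : Module.Basis (Fin 2) ℝ E) (h01 : B (b 0) (b 1) = 0) (h10 : B (b 1) (b 0) = 0) :
    sigNeg B.toQuadraticMap =
      (if B (b 0) (b 0) < 0 then 1 else 0) + (if B (b 1) (b 1) < 0 then 1 else 0) := by
  have hξ : b.coord 0 (b 0) ≠ 0 := by simp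
  have hcross : ∀ k ∈ LinearMap.ker (b.coord 0), B (b 0) k = 0 ∧ B k (b 0) = 0 := by
    intro k hk
    rw [ker_coord_zero_eq_span, Submodule.mem_span_singleton] at hk
    obtain ⟨t, rfl⟩ := hk
    simp [h01, h10]
  rw [LinearMap.BilinForm.sigNeg_eq_of_line_ker B hB hξ hcross]
  congr 1
  -- the restriction to the line `ℝ η`
  have hη : b 1 ≠ 0 := b.ne_zero 1
  set K := LinearMap.ker (b.coord 0) with hK
  have hηK : b 1 ∈ K := by simp [hK]
  let e : ℝ ≃ₗ[ℝ] K :=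
    (LinearEquiv.toSpanNonzeroSingleton ℝ E (b 1) hη).trans
      (LinearEquiv.ofEq _ _ (ker_coord_zero_eq_span b).symm)
  have he : ∀ t : ℝ, ((e t : K) : E) = t • b 1 := fun t ↦ rfl
  rw [← LinearMap.BilinForm.sigNeg_lineForm (B (b 1) (b 1))]
  refine sigNeg_eq_of_forall_apply_eq e.symm fun x y ↦ ?_
  obtain ⟨s, rfl⟩ := e.surjective x
  obtain ⟨t, rfl⟩ := e.surjective y
  rw [LinearEquiv.symm_apply_apply, LinearEquiv.symm_apply_apply,
    LinearMap.BilinForm.lineForm_apply]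
  show B ((e s : K) : E) ((e t : K) : E) = _
  rw [he, he, map_smul, map_smul, LinearMap.smul_apply, smul_eq_mul, smul_eq_mul]
  ring

/-- **Sign of the determinant versus negative index of inertia, dimension two.** Let `G` be a
symmetric positive definite bilinear form on a `2`-dimensional space, `L` an endomorphism, and
`B(v, w) = G(L v, w)` symmetric and nondegenerate. Then `det L ≠ 0` and
`det L / |det L| = (−1)^{b⁻(B)}`. (In a `B`-orthogonal basis, `det[B] = B(ξ,ξ) B(η,η)
= det L · det[G]` with `det[G] > 0`, and `b⁻(B)` counts the negative diagonal entries.)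
[cite: Milnor1963, §6 (index of grad f at a nondegenerate critical point)] -/
theorem det_div_abs_det_eq_neg_one_pow_sigNeg (h2 : finrank ℝ E = 2)
    (G : E →L[ℝ] E →L[ℝ] ℝ) (hGs : ∀ v w, G v w = G w v) (hGp : ∀ v, v ≠ 0 → 0 < G v v)
    (L : E →L[ℝ] E) {B : LinearMap.BilinForm ℝ E} (hBG : ∀ v w, B v w = G (L v) w)
    (hBs : B.IsSymm) (hBn : B.Nondegenerate) :
    LinearMap.det (L : E →ₗ[ℝ] E) ≠ 0 ∧
      LinearMap.det (L : E →ₗ[ℝ] E) / |LinearMap.det (L : E →ₗ[ℝ] E)| =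
        (-1 : ℝ) ^ sigNeg B.toQuadraticMap := by
  classical
  obtain ⟨b, h01, h10⟩ := exists_basis_fin_two_isOrtho h2 hBs
  -- the form `G` as a bilinear form, and `B = G.compLeft L`
  set Gb : LinearMap.BilinForm ℝ E := (ContinuousLinearMap.coeLM ℝ).comp G.toLinearMap with hGb
  have hGb : ∀ v w, Gb v w = G v w := fun v w ↦ rfl
  have hBc : B = Gb.compLeft (L : E →ₗ[ℝ] E) := by
    ext v w
    rw [LinearMap.BilinForm.compLeft_apply, hGb, hBG]
    rfl
  -- determinants in the basis `b`
  have hdetB : (LinearMap.BilinForm.toMatrix b B).det =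
      LinearMap.det (L : E →ₗ[ℝ] E) * (LinearMap.BilinForm.toMatrix b Gb).det := by
    rw [hBc, LinearMap.BilinForm.toMatrix_compLeft, Matrix.det_mul, Matrix.det_transpose,
      LinearMap.det_toMatrix]
  have hdetB' : (LinearMap.BilinForm.toMatrix b B).det = B (b 0) (b 0) * B (b 1) (b 1) := by
    rw [Matrix.det_fin_two]
    simp only [LinearMap.BilinForm.toMatrix_apply, h01, h10, mul_zero, sub_zero]
  have hdetG : (LinearMap.BilinForm.toMatrix b Gb).det =
      G (b 0) (b 0) * G (b 1) (b 1) - G (b 0) (b 1) ^ 2 := by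
    rw [Matrix.det_fin_two]
    simp only [LinearMap.BilinForm.toMatrix_apply, hGb, hGs (b 1) (b 0)]
    ring
  -- `det[G] > 0` (Cauchy–Schwarz for the independent vectors `b 0`, `b 1`)
  have hG11 : 0 < G (b 1) (b 1) := hGp _ (b.ne_zero 1)
  have hdetGpos : 0 < (LinearMap.BilinForm.toMatrix b Gb).det := by
    rw [hdetG]
    set v : E := G (b 1) (b 1) • b 0 - G (b 0) (b 1) • b 1 with hv
    have hv0 : v ≠ 0 := by
      intro h0
      have hli := b.linearIndependent
      rw [Fintype.linearIndependent_iff] at hli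
      have := hli (fun i ↦ if i = 0 then G (b 1) (b 1) else -G (b 0) (b 1)) (by
        rw [Fin.sum_univ_two]
        simp only [Fin.one_eq_zero_iff, OfNat.ofNat_ne_one, ↓reduceIte, neg_smul]
        rw [← sub_eq_add_neg]
        exact h0) 0
      simp only [↓reduceIte] at this
      exact hG11.ne' this
    have hpos := hGp v hv0
    have hexp : G v v = G (b 1) (b 1) * (G (b 0) (b 0) * G (b 1) (b 1) - G (b 0) (b 1) ^ 2) := by
      simp only [hv, map_sub, map_smul, _root_.sub_apply, _root_.smul_apply, smul_eq_mul,
        hGs (b 1) (b 0)]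
      ring
    rw [hexp] at hpos
    exact (mul_pos_iff_of_pos_left hG11).1 hpos
  -- nondegeneracy: `det[B] ≠ 0`
  have hdetB0 : (LinearMap.BilinForm.toMatrix b B).det ≠ 0 :=
    (LinearMap.BilinForm.nondegenerate_iff_det_ne_zero b).1 hBn
  have hdL : LinearMap.det (L : E →ₗ[ℝ] E) =
      B (b 0) (b 0) * B (b 1) (b 1) / (LinearMap.BilinForm.toMatrix b Gb).det := by
    rw [eq_div_iff hdetGpos.ne', ← hdetB, hdetB']
  have hdL0 : LinearMap.det (L : E →ₗ[ℝ] E) ≠ 0 := by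
    rw [hdL]
    exact div_ne_zero (hdetB' ▸ hdetB0) hdetGpos.ne'
  refine ⟨hdL0, ?_⟩
  have hB00 : B (b 0) (b 0) ≠ 0 := fun h ↦ hdetB0 (by rw [hdetB', h, zero_mul])
  have hB11 : B (b 1) (b 1) ≠ 0 := fun h ↦ hdetB0 (by rw [hdetB', h, mul_zero])
  rw [sigNeg_eq_of_basis_fin_two hBs b h01 h10, hdL]
  -- case analysis on the signs of the diagonal entries
  have key : ∀ x : ℝ, x ≠ 0 → x / |x| = if x < 0 then -1 else 1 := by
    intro x hx
    split_ifs with h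
    · rw [abs_of_neg h, div_neg, div_self hx]
    · rw [abs_of_pos (lt_of_le_of_ne (not_lt.1 h) (Ne.symm hx)), div_self hx]
  have hq : B (b 0) (b 0) * B (b 1) (b 1) / (LinearMap.BilinForm.toMatrix b Gb).det /
      |B (b 0) (b 0) * B (b 1) (b 1) / (LinearMap.BilinForm.toMatrix b Gb).det| =
      (B (b 0) (b 0) / |B (b 0) (b 0)|) * (B (b 1) (b 1) / |B (b 1) (b 1)|) := by
    rw [abs_div, abs_mul, abs_of_pos hdetGpos]
    field_simp
  rw [hq, key _ hB00, key _ hB11]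
  split_ifs <;> norm_num

end LinearAlgebra


/-! ### Smoothness of the normalized acceleration field off the zeros -/

section NormalizedAcceleration

variable {E : Type*} [NormedAddCommGroup E] [NormedSpace ℝ E] {H : Type*} [TopologicalSpace H]
  {I : ModelWithCorners ℝ E H} {M : Type*} [TopologicalSpace M] [ChartedSpace H M]
  [IsManifold I ∞ M] [FiniteDimensional ℝ E] [I.Boundaryless]

omit [FiniteDimensional ℝ E] [I.Boundaryless] in
/-- **Converse chart criterion for smoothness of a vector field**: if near `y` the chart
representative `vectorRep I x₁ Y ∘ φ` agrees with `F ∘ φ` for an `F` smooth at `φ y`, then `Y` is a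
smooth section at `y` (Mathlib's `Trivialization.contMDiffAt_section_iff` for the trivialization of
`TM` at `x₁`, which reads vectors through `Dφ`). [folklore] -/
theorem contMDiffAt_section_of_vectorRep (x₁ : M) {Y : Π x : M, TangentSpace I x} {F : E → E}
    {y : M} (hy : y ∈ (chartAt H x₁).source) (hF : ContDiffAt ℝ ∞ F (extChartAt I x₁ y))
    (hYF : ∀ᶠ z in 𝓝 y, vectorRep I x₁ Y (extChartAt I x₁ z) = F (extChartAt I x₁ z)) :
    CMDiffAt ∞ (T% Y) y := by
  set e := trivializationAt E (TangentSpace I : M → Type _) x₁ with he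
  have hbase : (chartAt H x₁).source ⊆ e.baseSet := by simp [he]
  rw [e.contMDiffAt_section_iff (hbase hy)]
  have h1 : ContMDiffAt I 𝓘(ℝ, E) ∞ (F ∘ extChartAt I x₁) y :=
    hF.contMDiffAt.comp y (contMDiffAt_extChartAt' hy)
  refine h1.congr_of_eventuallyEq ?_
  filter_upwards [hYF, (chartAt H x₁).open_source.mem_nhds hy] with z hz hzs
  rw [Function.comp_apply, ← hz, vectorRep_apply, (extChartAt I x₁).left_inv
    (by rwa [extChartAt_source]), ← TangentBundle.continuousLinearMapAt_trivializationAt hzs]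
  exact (Trivialization.continuousLinearMapAt_apply_of_mem (R := ℝ) _ (hbase hzs) _).symm

variable [CompleteSpace E] (g : PseudoRiemannianMetric I ∞ E (TangentSpace I : M → Type _))
  [g.HasLeviCivita]

omit [FiniteDimensional ℝ E] [I.Boundaryless] [CompleteSpace E] [g.HasLeviCivita] in
/-- `Ĝ_e(Ŷ e, Ŷ e) = g(Y, Y)` at `φ⁻¹ e`, for `e` in the chart target. [folklore] -/
theorem metricRep_vectorRep_self (x₁ : M) (Y : Π x : M, TangentSpace I x) {e : E}
    (he : e ∈ (extChartAt I x₁).target) :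
    metricRep I g x₁ e (vectorRep I x₁ Y e) (vectorRep I x₁ Y e) =
      g.val ((extChartAt I x₁).symm e) (Y ((extChartAt I x₁).symm e))
        (Y ((extChartAt I x₁).symm e)) := by
  have hy : (extChartAt I x₁).symm e ∈ (chartAt H x₁).source := by
    rw [← extChartAt_source I]; exact (extChartAt I x₁).map_target he
  rw [metricRep_apply_eq_val_symmL, vectorRep_apply, C0Extension.symmL_mfderiv_extChartAt hy]

set_option maxSynthPendingDepth 2 in
/-- **The normalized acceleration field is smooth where the field does not vanish (metrically)**:
for a smooth vector field `Y` and a point `x` with `g(Y_x, Y_x) ≠ 0`, the field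
`(∇_Y Y − (div Y) Y)/g(Y, Y)` (`normalizedAcceleration`) is a smooth section at `x`. In the chart at
`x` its representative is `(Ĝ(Ŷ,Ŷ))⁻¹ (DŶ(Ŷ) + Γ(Ŷ,Ŷ) − tr(DŶ + Γ(Ŷ, ·)) Ŷ)`
(`vectorRep_normalizedAcceleration`), smooth in the smooth data `Ĝ`, `Γ`, `Ŷ`. [folklore] -/
theorem contMDiffAt_normalizedAcceleration {Y : Π x : M, TangentSpace I x} (hY : CMDiff ∞ (T% Y))
    {x : M} (hx : g.val x (Y x) (Y x) ≠ 0) :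
    CMDiffAt ∞ (T% (normalizedAcceleration g Y)) x := by
  set φ := extChartAt I x with hφ
  set c := φ x with hc
  set Ĝ := metricRep I g x with hĜ
  set Ŷ := vectorRep I x Y with hŶ
  have hct : c ∈ φ.target := mem_extChartAt_target x
  have hT : φ.target ∈ 𝓝 c := (isOpen_extChartAt_target x).mem_nhds hct
  have hxs : x ∈ (chartAt H x).source := mem_chart_source H x
  have hĜm : IsMetricOn Ĝ φ.target :=
    Lorentzian.OpensChart.isMetricOn_repr (val_chartPullback_eq_metricRep g x)
  -- smoothness of the data at `c`
  have hĜa : ContDiffAt ℝ ∞ Ĝ c := (contDiffOn_chartRep_const g x).contDiffAt hT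
  have hŶa : ContDiffAt ℝ ∞ Ŷ c := (contDiffOn_vectorRep x hY.contMDiffOn).contDiffAt hT
  have hΓa : ContDiffAt ℝ ∞ (chrAt Ĝ) c := hĜm.contDiffAt_chrAt hct
  have hDŶa : ContDiffAt ℝ ∞ (fderiv ℝ Ŷ) c := hŶa.fderiv_right (m := ∞) (by simp)
  -- the representative and its smoothness at `c`
  set F : E → E := fun e ↦ (Ĝ e (Ŷ e) (Ŷ e))⁻¹ • (covDAt Ĝ Ŷ e (Ŷ e) - divAt Ĝ Ŷ e • Ŷ e)
    with hF
  have hq0 : Ĝ c (Ŷ c) (Ŷ c) ≠ 0 := by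
    rw [hĜ, hŶ, metricRep_vectorRep_self g x Y hct]
    have : φ.symm c = x := extChartAt_to_inv x
    rw [this]
    exact hx
  have hq : ContDiffAt ℝ ∞ (fun e ↦ Ĝ e (Ŷ e) (Ŷ e)) c := (hĜa.clm_apply hŶa).clm_apply hŶa
  have hcov : ContDiffAt ℝ ∞ (fun e ↦ covDAt Ĝ Ŷ e) c := by
    simp only [covDAt]
    exact hDŶa.add (hΓa.clm_apply hŶa)
  have hcovY : ContDiffAt ℝ ∞ (fun e ↦ covDAt Ĝ Ŷ e (Ŷ e)) c := hcov.clm_apply hŶa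
  have hdiv : ContDiffAt ℝ ∞ (fun e ↦ divAt Ĝ Ŷ e) c := by
    simp only [divAt_eq]
    exact (traceCLM E).contDiff.contDiffAt.comp c hcov
  have hFa : ContDiffAt ℝ ∞ F c := (hq.inv hq0).smul (hcovY.sub (hdiv.smul hŶa))
  -- conclude by the chart criterion
  refine contMDiffAt_section_of_vectorRep x hxs hFa ?_
  filter_upwards [(chartAt H x).open_source.mem_nhds hxs] with z hz
  have hzt : φ z ∈ φ.target := φ.map_source (by rwa [hφ, extChartAt_source])
  exact vectorRep_normalizedAcceleration g x hY.contMDiffOn ⟨φ z, hzt⟩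

/-- For a Riemannian metric the normalized acceleration field of a smooth vector field is smooth
off the zeros of the field. [folklore] -/
theorem contMDiffAt_normalizedAcceleration_of_ne_zero (hg : g.IsRiemannian)
    {Y : Π x : M, TangentSpace I x} (hY : CMDiff ∞ (T% Y)) {x : M} (hx : Y x ≠ 0) :
    CMDiffAt ∞ (T% (normalizedAcceleration g Y)) x :=
  contMDiffAt_normalizedAcceleration g hY (hg x (Y x) hx).ne'

end NormalizedAcceleration

/-! ### The linearization of the gradient of a Morse function on a surface -/

section Surface

variable {N : Type*} [TopologicalSpace N] [ChartedSpace (EuclideanSpace ℝ (Fin 2)) N]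
  [IsManifold (𝓡 2) ∞ N]
  (h : ContMDiffRiemannianMetric (𝓡 2) ∞ (EuclideanSpace ℝ (Fin 2))
    (TangentSpace (𝓡 2) : N → Type _))

omit [IsManifold (𝓡 2) ∞ N] in
/-- The Hessian of the tree (`mhessian`) on a boundaryless Euclidean model is the second Fréchet
derivative of the function read in the extended chart. [cite: Milnor1963, §2] -/
theorem mhessian_two_apply (f : N → ℝ) (p : N) (v w : EuclideanSpace ℝ (Fin 2)) :
    mhessian (𝓡 2) f p v w =
      fderiv ℝ (fderiv ℝ (f ∘ (extChartAt (𝓡 2) p).symm)) (extChartAt (𝓡 2) p p) v w := by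
  have hw : writtenInExtChartAt (𝓡 2) 𝓘(ℝ, ℝ) p f = f ∘ (extChartAt (𝓡 2) p).symm := by
    ext u; simp [writtenInExtChartAt]
  show (fderivWithin ℝ (fderivWithin ℝ (writtenInExtChartAt (𝓡 2) 𝓘(ℝ, ℝ) p f)
    (range (𝓡 2))) (range (𝓡 2)) (extChartAt (𝓡 2) p p) v) w = _
  rw [hw, ModelWithCorners.Boundaryless.range_eq_univ (I := 𝓡 2), fderivWithin_univ,
    fderivWithin_univ]

/-- **The linearization of `grad f` at a critical point of a Morse function on a Riemannian
surface**: the derivative `L` at `φ p` of the chart representative of `grad f` is invertible, and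
`det L / |det L| = (−1)^{index_p f}` (Milnor 1963, §6: the index of the gradient field at a
nondegenerate critical point of index `λ` is `(−1)^λ`). [cite: Milnor1963, §6] -/
theorem exists_linearization_grad {f : N → ℝ} (hf : IsMorse (𝓡 2) f) {p : N}
    (hp : IsMCriticalPt (𝓡 2) f p) :
    ∃ L : EuclideanSpace ℝ (Fin 2) ≃L[ℝ] EuclideanSpace ℝ (Fin 2),
      fderiv ℝ (vectorRep (𝓡 2) p (grad (ofRiemannian h) f)) (extChartAt (𝓡 2) p p) = L ∧
      LinearMap.det (L : EuclideanSpace ℝ (Fin 2) →ₗ[ℝ] EuclideanSpace ℝ (Fin 2)) /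
          |LinearMap.det (L : EuclideanSpace ℝ (Fin 2) →ₗ[ℝ] EuclideanSpace ℝ (Fin 2))| =
        (-1 : ℝ) ^ morseIndex (𝓡 2) f p := by
  set g := ofRiemannian h with hg
  set φ := extChartAt (𝓡 2) p with hφ
  set c := φ p with hc
  set L₀ := fderiv ℝ (vectorRep (𝓡 2) p (grad g f)) c with hL₀
  have h2 : finrank ℝ (EuclideanSpace ℝ (Fin 2)) = 2 := finrank_euclideanSpace_fin
  have hpc : φ.symm c = p := extChartAt_to_inv p
  have hps : p ∈ (chartAt (EuclideanSpace ℝ (Fin 2)) p).source := mem_chart_source _ p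
  -- the metric at `c` in the chart
  set G := metricRep (𝓡 2) g p c with hG
  have hGs : ∀ v w, G v w = G w v := fun v w ↦ by
    simp only [hG, metricRep_apply_eq_val_symmL]
    exact g.symm _ _ _
  have hGp : ∀ v, v ≠ 0 → 0 < G v v := by
    intro v hv
    simp only [hG, metricRep_apply_eq_val_symmL]
    refine h.pos _ _ fun h0 ↦ hv ?_
    have hy : φ.symm c ∈ (chartAt (EuclideanSpace ℝ (Fin 2)) p).source := by rw [hpc]; exact hps
    have := congrArg (mfderiv (𝓡 2) 𝓘(ℝ, EuclideanSpace ℝ (Fin 2)) φ (φ.symm c)) h0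
    rwa [map_zero, mfderiv_extChartAt_symmL hy v] at this
  -- the Hessian
  have hBG : ∀ v w, mhessian (𝓡 2) f p v w = G (L₀ v) w := by
    intro v w
    rw [mhessian_two_apply, ← metricRep_fderiv_vectorRep_grad g p hf.contMDiff hp v w]
  have hBs : (mhessian (𝓡 2) f p).IsSymm :=
    LinearMap.BilinForm.isSymm_iff.2 (mhessian_isSymm_holds (hf.contMDiff.of_le (by norm_cast)) p)
  have hBn : (mhessian (𝓡 2) f p).Nondegenerate := hf.nondegenerate hp
  obtain ⟨hdet, hsign⟩ :=
    det_div_abs_det_eq_neg_one_pow_sigNeg h2 G hGs hGp L₀ hBG hBs hBn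
  -- upgrade `L₀` to an equivalence
  let Le : EuclideanSpace ℝ (Fin 2) ≃ₗ[ℝ] EuclideanSpace ℝ (Fin 2) :=
    LinearMap.equivOfDetNeZero (L₀ : EuclideanSpace ℝ (Fin 2) →ₗ[ℝ] EuclideanSpace ℝ (Fin 2)) hdet
  refine ⟨Le.toContinuousLinearEquiv, ?_, ?_⟩
  · ext v
    rfl
  · exact hsign

end Surface

end Literature.Geometry.Riemannian

end
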